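import Mathlib.Tactic.Common
import HarnessLib

/-!
# A static-order exhaustive search for proper 3-colourings, with its completeness theorem

Support module for the kernel certificate that the 70-vertex cubic graph `G70` of
`Literature.Combinatorics.SimpleGraph.BrinkmannTuckerVanCleemput2021.G70` has chromatic index 4
(module `…ClassTwo`), which answers the first question of G. Brinkmann, T. Tucker, N. Van Cleemput,
*On the genera of polyhedral embeddings of cubic graphs*, DMTCS **23**:3 (2021) #4, §3.1
[BrinkmannTuckerVancleemput2021].

The device is generic and graph-free.  The objects to be coloured ("edges") are natural numbers,
a colouring is `c : ℕ → ℕ` with values `< 3`, and a conflict relation is a Boolean `adjE`.  A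
search PROGRAM is a list of steps `(e, chk)`: "push the colour of edge `e` on the stack, and require
it to differ from the colours already on the stack at the positions `chk`".  `run leaf P st` tries
all `3 ^ P.length` colour stacks in depth-first order, pruning a branch as soon as a `chk` fails,
and evaluates `leaf` at the surviving full stacks; it answers whether SOME branch succeeds.  The
program is STATIC: which edge is pushed at which depth, and which positions are compared, do not
depend on the colours — so the meaning of every stack cell is a fixed edge, recorded by the ghost
list `as` (`final P as` after the whole program), and `valid adjE P as` checks, once and for all and
decidably, that every comparison a program makes is between two conflicting edges.

`run_complete`: if `c` is a colouring in which conflicting edges get different colours, the program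
is valid, and `leaf` accepts the full stack of `c`-colours, then `run` answers `true`.  Hence
`run … = false` (evaluated by the kernel, `decide +kernel`) refutes the existence of such a `c`.
Only this direction (completeness) is needed for a non-colourability certificate; nothing is
claimed about branches the search accepts.

Provenance: refutations bundle `papers/_cross/refutations` (H21 seat pub-refute-2, 2026-08-18),
written for the tree under the Lean-in-tree rule (human 2026-08-18).
-/

namespace Literature.Combinatorics.SimpleGraph.BrinkmannTuckerVanCleemput2021

/-- `chkTop x st chk`: the colour `x` differs from the stack entries `st[j]`, `j ∈ chk`
(out-of-range positions read `0`). [folklore] -/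
def chkTop (x : ℕ) (st : List ℕ) : List ℕ → Bool
  | [] => true
  | j :: r => !(Nat.beq x (st.getD j 0)) && chkTop x st r

/-- The search: for each step `(e, chk)` try the colours `0, 1, 2` for the new top cell, keep a
colour only if it differs from the cells at positions `chk` of the current stack, recurse; at the
end of the program evaluate `leaf` on the full stack.  `true` iff some branch reaches an accepting
leaf. [folklore] -/
def run (leaf : List ℕ → Bool) : List (ℕ × List ℕ) → List ℕ → Bool
  | [], st => leaf st
  | s :: P, st =>
      (chkTop 0 st s.2 && run leaf P (0 :: st)) ||
      ((chkTop 1 st s.2 && run leaf P (1 :: st)) ||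
      (chkTop 2 st s.2 && run leaf P (2 :: st)))

/-- The ghost list of edges whose colours the stack holds after running program `P` from ghost
list `as` (head = top of stack). [folklore] -/
def final : List (ℕ × List ℕ) → List ℕ → List ℕ
  | [], as => as
  | s :: P, as => final P (s.1 :: as)

/-- Validity of one step: every compared position is in range and holds an edge in conflict with
the pushed edge `e`. [folklore] -/
def validChk (adjE : ℕ → ℕ → Bool) (e : ℕ) (as : List ℕ) : List ℕ → Bool
  | [] => true
  | j :: r => (decide (j < as.length) && adjE e (as.getD j 0)) && validChk adjE e as r

/-- Validity of a program from ghost list `as`: every step is valid (`validChk`) for the ghost list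
current at that step. [folklore] -/
def valid (adjE : ℕ → ℕ → Bool) : List (ℕ × List ℕ) → List ℕ → Bool
  | [], _ => true
  | s :: P, as => validChk adjE s.1 as s.2 && valid adjE P (s.1 :: as)

/-- Reading an in-range cell of a mapped list. [folklore] -/
theorem getD_map_of_lt (c : ℕ → ℕ) :
    ∀ (l : List ℕ) (j : ℕ), j < l.length → (l.map c).getD j 0 = c (l.getD j 0)
  | [], _, h => absurd h (Nat.not_lt_zero _)
  | _ :: _, 0, _ => rfl
  | _ :: l, j + 1, h => by
      simp only [List.map_cons, List.getD_cons_succ]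
      exact getD_map_of_lt c l j (by simpa using h)

/-- A valid step's comparisons all succeed on the stack of colours of a conflict-respecting
colouring. [folklore] -/
theorem chkTop_complete {adjE : ℕ → ℕ → Bool} {c : ℕ → ℕ}
    (hadj : ∀ e f, adjE e f = true → c e ≠ c f) (e : ℕ) (as : List ℕ) :
    ∀ chk : List ℕ, validChk adjE e as chk = true → chkTop (c e) (as.map c) chk = true
  | [], _ => rfl
  | j :: r, h => by
      simp only [validChk, Bool.and_eq_true, decide_eq_true_eq] at h
      obtain ⟨⟨hj, he⟩, hr⟩ := h
      simp only [chkTop, Bool.and_eq_true, getD_map_of_lt c as j hj]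
      refine ⟨?_, chkTop_complete hadj e as r hr⟩
      cases hb : Nat.beq (c e) (c (as.getD j 0)) with
      | false => rfl
      | true => exact absurd (Nat.eq_of_beq_eq_true hb) (hadj _ _ he)

/-- **Completeness of the static search.**  If conflicting edges get different colours under `c`
(values `< 3`), the program `P` is valid from the ghost list `as`, and `leaf` accepts the final
stack of `c`-colours, then `run leaf P (as.map c) = true`. [folklore] -/
theorem run_complete {adjE : ℕ → ℕ → Bool} {c : ℕ → ℕ} (hc : ∀ e, c e < 3)
    (hadj : ∀ e f, adjE e f = true → c e ≠ c f) (leaf : List ℕ → Bool) :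
    ∀ (P : List (ℕ × List ℕ)) (as : List ℕ), valid adjE P as = true →
      leaf ((final P as).map c) = true → run leaf P (as.map c) = true
  | [], _, _, hleaf => hleaf
  | s :: P, as, hv, hleaf => by
      simp only [valid, Bool.and_eq_true] at hv
      obtain ⟨hchk, hP⟩ := hv
      have ih := run_complete hc hadj leaf P (s.1 :: as) hP hleaf
      have hct := chkTop_complete hadj s.1 as s.2 hchk
      rw [List.map_cons] at ih
      have h3 := hc s.1
      simp only [run]
      rcases (by omega : c s.1 = 0 ∨ c s.1 = 1 ∨ c s.1 = 2) with h | h | h <;>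
        rw [h] at ih hct <;> simp [ih, hct]

/-- Base-3 digits of `i < 81`, least significant first, as a stack of four colours. [folklore] -/
def dec (i : ℕ) : List ℕ := [i % 3, i / 3 % 3, i / 9 % 3, i / 27 % 3]

/-- The base-3 code read off four stack positions. [folklore] -/
def code (st : List ℕ) (p : ℕ × ℕ × ℕ × ℕ) : ℕ :=
  st.getD p.1 0 + 3 * (st.getD p.2.1 0 + 3 * (st.getD p.2.2.1 0 + 3 * st.getD p.2.2.2 0))

/-- `dec` inverts the base-3 code of four colours. [folklore] -/
theorem dec_code (a b d e : ℕ) (ha : a < 3) (hb : b < 3) (hd : d < 3) (he : e < 3) :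
    dec (a + 3 * (b + 3 * (d + 3 * e))) = [a, b, d, e] := by
  simp only [dec, List.cons.injEq, and_true]
  omega

/-- The code of four colours is `< 81`. [folklore] -/
theorem code_lt (a b d e : ℕ) (ha : a < 3) (hb : b < 3) (hd : d < 3) (he : e < 3) :
    a + 3 * (b + 3 * (d + 3 * e)) < 81 := by
  omega

/-- Reading the code of four in-range cells of a mapped stack. [folklore] -/
theorem code_map (c : ℕ → ℕ) (l : List ℕ) (p : ℕ × ℕ × ℕ × ℕ) (h1 : p.1 < l.length)
    (h2 : p.2.1 < l.length) (h3 : p.2.2.1 < l.length) (h4 : p.2.2.2 < l.length) :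
    code (l.map c) p = c (l.getD p.1 0) +
      3 * (c (l.getD p.2.1 0) + 3 * (c (l.getD p.2.2.1 0) + 3 * c (l.getD p.2.2.2 0))) := by
  simp only [code, getD_map_of_lt c l _ h1, getD_map_of_lt c l _ h2, getD_map_of_lt c l _ h3,
    getD_map_of_lt c l _ h4]

end Literature.Combinatorics.SimpleGraph.BrinkmannTuckerVanCleemput2021
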